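import Summits.AtomisticToContinuum.BoseEinsteinCondensation.Theorems.LatticeODLROOffHalfFilling.Negative.OffHalfFillingForced

/-!
# Route `BECGroundStateSOS`, crux `LatticeODLROOffHalfFilling` (stmt-AtomisticToContinuum-11033),
# line `Sketch`: the registered stub `stub_kineticBound`

Supports (does not close) stmt-AtomisticToContinuum-11033. The kinetic (hopping) energy of hard-core
bosons on the torus `(ℤ/Lℤ)³` in a fixed magnetisation sector: for an `S³_tot`-eigenvector `v` with
eigenvalue `M`,
`Re⟨v, H_XY v⟩ ≥ −3(L³/2 − |M|)‖v‖²`, `H_XY = xyTorus 3 L 1 = −Σ_x Σ_i hop(x, x+eᵢ)` (`L ≥ 3`).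

Proof: the two sum-of-squares forms of the bond operator (`x ≠ y`)
`hop_{xy} = ½(P↓_x + P↓_y) − ½(S⁺_x − S⁺_y)ᴴ(S⁺_x − S⁺_y)` (`hop_eq_sub`, DOWN form) and
`hop_{xy} = 1 − ½(P↓_x + P↓_y) − ½(S⁺_x − S⁺_y)(S⁺_x − S⁺_y)ᴴ` (`hop_eq_up`, UP form) give
`Re⟨v, hop_{xy} v⟩ ≤ ½(⟨P↓_x⟩ + ⟨P↓_y⟩)` and `≤ ‖v‖² − ½(⟨P↓_x⟩ + ⟨P↓_y⟩)`; summing over the `3L³`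
directed bonds (each site lies on `6` of them) and using `Σ_x P↓_x = L³/2 − S³_tot`
(`totalSpin_two_eq`) gives `Re⟨v, H_XY v⟩ ≥ −3(L³/2 ∓ M)‖v‖²`, i.e. `≥ −3(L³/2 − |M|)‖v‖²`.
All [folklore].
-/

noncomputable section

namespace Summit.AtomisticToContinuum.BoseEinsteinCondensation.Theorems.LatticeODLROOffHalfFilling.Ladder

open Literature.MathematicalPhysics.QuantumLattice Literature.Probability.LatticeModels Matrix Finset
open Summit.AtomisticToContinuum.BoseEinsteinCondensation.Theorems.LatticeODLROOffHalfFilling.Negative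
open scoped ComplexOrder BigOperators

/-- `Re⟨v, Cᴴ C v⟩ = ‖C v‖² ≥ 0`. [folklore] -/
private theorem re_quad_conjTranspose_mul_self_nonneg {m : Type*} [Fintype m] (C : Matrix m m ℂ)
    (v : m → ℂ) : 0 ≤ (star v ⬝ᵥ (Cᴴ * C) *ᵥ v).re := by
  rw [star_dotProduct_conjTranspose_mul_mulVec]
  exact (Complex.nonneg_iff.mp (dotProduct_star_self_nonneg _)).1

/-- `Re⟨v, C Cᴴ v⟩ = ‖Cᴴ v‖² ≥ 0`. [folklore] -/
private theorem re_quad_mul_conjTranspose_self_nonneg {m : Type*} [Fintype m] (C : Matrix m m ℂ)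
    (v : m → ℂ) : 0 ≤ (star v ⬝ᵥ (C * Cᴴ) *ᵥ v).re := by
  simpa only [conjTranspose_conjTranspose] using re_quad_conjTranspose_mul_self_nonneg Cᴴ v

/-- `Re(½ z) = ½ Re z`. [folklore] -/
private theorem re_half_mul (z : ℂ) : ((1 / 2 : ℂ) * z).re = 1 / 2 * z.re := by
  rw [show (1 / 2 : ℂ) = ((1 / 2 : ℝ) : ℂ) by norm_num, Complex.re_ofReal_mul]

section Bond

variable {Λ : Type*} [Fintype Λ] [DecidableEq Λ]

/-- SOS identity, UP form: `hop_{xy} = 1 − ½(P↓_x + P↓_y) − ½ (S⁺_x − S⁺_y)(S⁺_x − S⁺_y)ᴴ` for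
`x ≠ y` (uses `S⁺_xS⁻_x = 1 − P↓_x = P↑_x`). [folklore] -/
private theorem hop_eq_up {x y : Λ} (hxy : x ≠ y) :
    hop x y = (1 : Op Λ 2) - (1 / 2 : ℂ) • (Pd x + Pd y) -
      (1 / 2 : ℂ) • ((E x - E y) * (E x - E y)ᴴ) := by
  have hcomm : (E x)ᴴ * E y = E y * (E x)ᴴ := by
    rw [E_conjTranspose, E, onSite_mul_onSite_comm hxy]
  rw [hop_eq, conjTranspose_sub, sub_mul, mul_sub, mul_sub, E_mul_conjTranspose,
    E_mul_conjTranspose, hcomm]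
  module

/-- DOWN per-bond bound: `Re⟨v, hop_{xy} v⟩ ≤ ½(Re⟨v, P↓_x v⟩ + Re⟨v, P↓_y v⟩)` (`x ≠ y`).
[folklore] -/
private theorem re_quad_hop_le_down {x y : Λ} (hxy : x ≠ y) (v : TensorIndex Λ 2 → ℂ) :
    (star v ⬝ᵥ hop x y *ᵥ v).re ≤
      1 / 2 * ((star v ⬝ᵥ Pd x *ᵥ v).re + (star v ⬝ᵥ Pd y *ᵥ v).re) := by
  have hpos := re_quad_conjTranspose_mul_self_nonneg (E x - E y) v
  rw [hop_eq_sub hxy, sub_mulVec, smul_mulVec, smul_mulVec, add_mulVec, dotProduct_sub,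
    dotProduct_smul, dotProduct_smul, dotProduct_add, smul_eq_mul, smul_eq_mul, Complex.sub_re,
    re_half_mul, re_half_mul, Complex.add_re]
  linarith

/-- UP per-bond bound: `Re⟨v, hop_{xy} v⟩ ≤ ‖v‖² − ½(Re⟨v, P↓_x v⟩ + Re⟨v, P↓_y v⟩)` (`x ≠ y`).
[folklore] -/
private theorem re_quad_hop_le_up {x y : Λ} (hxy : x ≠ y) (v : TensorIndex Λ 2 → ℂ) :
    (star v ⬝ᵥ hop x y *ᵥ v).re ≤
      (star v ⬝ᵥ v).re - 1 / 2 * ((star v ⬝ᵥ Pd x *ᵥ v).re + (star v ⬝ᵥ Pd y *ᵥ v).re) := by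
  have hpos := re_quad_mul_conjTranspose_self_nonneg (E x - E y) v
  rw [hop_eq_up hxy, sub_mulVec, sub_mulVec, smul_mulVec, smul_mulVec, add_mulVec, one_mulVec,
    dotProduct_sub, dotProduct_sub, dotProduct_smul, dotProduct_smul, dotProduct_add, smul_eq_mul,
    smul_eq_mul, Complex.sub_re, Complex.sub_re, re_half_mul, re_half_mul, Complex.add_re]
  linarith

/-- `Σ_x Re⟨v, P↓_x v⟩ = (|Λ|/2 − M)‖v‖²` for an `S³_tot`-eigenvector `v` with eigenvalue `M`
(`S³_tot = |Λ|/2 − Σ_x P↓_x`). [folklore] -/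
private theorem sum_re_quad_Pd_eq (M : ℝ) (v : TensorIndex Λ 2 → ℂ)
    (hv : (totalSpin 1 2 : Op Λ 2) *ᵥ v = (M : ℂ) • v) :
    ∑ x : Λ, (star v ⬝ᵥ Pd x *ᵥ v).re =
      ((Fintype.card Λ : ℝ) / 2 - M) * (star v ⬝ᵥ v).re := by
  have hsumPd : (∑ x : Λ, Pd x : Op Λ 2) =
      ((Fintype.card Λ : ℂ) / 2) • (1 : Op Λ 2) - totalSpin 1 2 := by
    rw [totalSpin_two_eq, sub_sub_cancel]
  rw [← Complex.re_sum, ← dotProduct_sum, ← Matrix.sum_mulVec, hsumPd, sub_mulVec, smul_mulVec,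
    one_mulVec, hv, dotProduct_sub, dotProduct_smul, dotProduct_smul, smul_eq_mul, smul_eq_mul,
    ← sub_mul,
    show ((Fintype.card Λ : ℂ) / 2 - (M : ℂ)) = (((Fintype.card Λ : ℝ) / 2 - M : ℝ) : ℂ) by
      push_cast; ring,
    Complex.re_ofReal_mul]

end Bond

/-- **Kinetic bound in a magnetisation sector.** For an `S³_tot`-eigenvector `v` (eigenvalue `M`),
`Re⟨v, H_XY v⟩ ≥ −3(L³/2 − |M|)‖v‖²`: per bond `Re⟨hop_{xy}⟩ ≤ ½⟨P↓_x + P↓_y⟩` and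
`≤ ½⟨P↑_x + P↑_y⟩` (Cauchy–Schwarz), each site lies on `6` bonds, `Σ_x P↓_x = L³/2 − S³_tot`.
[folklore] -/
theorem stub_kineticBound (L : ℕ) [NeZero L] (hL : 3 ≤ L) (M : ℝ)
    (v : TensorIndex (TorusSite 3 L) 2 → ℂ)
    (hv : (totalSpin 1 2 : Op (TorusSite 3 L) 2) *ᵥ v = (M : ℂ) • v) :
    -(3 * ((L : ℝ) ^ 3 / 2 - |M|)) * (star v ⬝ᵥ v).re ≤
      (star v ⬝ᵥ (xyTorus 3 L 1) *ᵥ v).re := by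
  have hL2 : 2 ≤ L := by omega
  set n : ℝ := (star v ⬝ᵥ v).re with hn
  set p : TorusSite 3 L → ℝ := fun x => (star v ⬝ᵥ Pd x *ᵥ v).re with hp
  -- the Hamiltonian as minus the sum of the hopping terms over the `3L³` directed bonds
  have hH : (star v ⬝ᵥ (xyTorus 3 L 1) *ᵥ v).re =
      -∑ x : TorusSite 3 L, ∑ i : Fin 3, (star v ⬝ᵥ hop x (x + Pi.single i 1) *ᵥ v).re := by
    have e : xyTorus 3 L 1 = -∑ x : TorusSite 3 L, ∑ i : Fin 3, hop x (x + Pi.single i 1) :=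
      xxz_eq L hL
    rw [e, Matrix.neg_mulVec, dotProduct_neg, Complex.neg_re, Matrix.sum_mulVec, dotProduct_sum,
      Complex.re_sum]
    congr 1
    refine Finset.sum_congr rfl fun x _ => ?_
    rw [Matrix.sum_mulVec, dotProduct_sum, Complex.re_sum]
  have hne : ∀ (x : TorusSite 3 L) (i : Fin 3), x ≠ x + Pi.single i 1 := fun x i h =>
    torus_single_ne_zero hL2 i (left_eq_add.mp h)
  -- each site lies on `6` directed bonds
  have hshift : ∀ i : Fin 3, ∑ x : TorusSite 3 L, p (x + Pi.single i 1) = ∑ x, p x := fun i =>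
    Equiv.sum_comp (Equiv.addRight (Pi.single i 1)) p
  have hdouble : ∑ x : TorusSite 3 L, ∑ i : Fin 3, (p x + p (x + Pi.single i 1)) =
      6 * ∑ x, p x := by
    rw [Finset.sum_comm]
    simp only [Finset.sum_add_distrib, hshift]
    rw [Finset.sum_const, Finset.card_univ, Fintype.card_fin, nsmul_eq_mul]
    push_cast
    ring
  have hcard : (Fintype.card (TorusSite 3 L) : ℝ) = (L : ℝ) ^ 3 := by
    have h : Fintype.card (TorusSite 3 L) = L ^ 3 := by simp [ZMod.card, Fintype.card_fin]
    rw [h]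
    push_cast
    rfl
  -- `Σ_x ⟨P↓_x⟩ = (L³/2 − M)‖v‖²`
  have hsum : ∑ x, p x = ((L : ℝ) ^ 3 / 2 - M) * n := by
    simp only [hp, hn]
    rw [sum_re_quad_Pd_eq M v hv, hcard]
  -- DOWN: `Σ_bonds Re⟨hop⟩ ≤ 3 Σ_x ⟨P↓_x⟩`
  have hB1 : ∑ x : TorusSite 3 L, ∑ i : Fin 3, (star v ⬝ᵥ hop x (x + Pi.single i 1) *ᵥ v).re ≤
      3 * ∑ x, p x := by
    calc ∑ x : TorusSite 3 L, ∑ i : Fin 3, (star v ⬝ᵥ hop x (x + Pi.single i 1) *ᵥ v).re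
        ≤ ∑ x : TorusSite 3 L, ∑ i : Fin 3, 1 / 2 * (p x + p (x + Pi.single i 1)) :=
          Finset.sum_le_sum fun x _ => Finset.sum_le_sum fun i _ => re_quad_hop_le_down (hne x i) v
      _ = 1 / 2 * ∑ x : TorusSite 3 L, ∑ i : Fin 3, (p x + p (x + Pi.single i 1)) := by
          rw [Finset.mul_sum]
          refine Finset.sum_congr rfl fun x _ => ?_
          rw [Finset.mul_sum]
      _ = 3 * ∑ x, p x := by rw [hdouble]; ring
  -- UP: `Σ_bonds Re⟨hop⟩ ≤ 3L³‖v‖² − 3 Σ_x ⟨P↓_x⟩`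
  have hB2 : ∑ x : TorusSite 3 L, ∑ i : Fin 3, (star v ⬝ᵥ hop x (x + Pi.single i 1) *ᵥ v).re ≤
      3 * (L : ℝ) ^ 3 * n - 3 * ∑ x, p x := by
    calc ∑ x : TorusSite 3 L, ∑ i : Fin 3, (star v ⬝ᵥ hop x (x + Pi.single i 1) *ᵥ v).re
        ≤ ∑ x : TorusSite 3 L, ∑ i : Fin 3, (n - 1 / 2 * (p x + p (x + Pi.single i 1))) :=
          Finset.sum_le_sum fun x _ => Finset.sum_le_sum fun i _ => re_quad_hop_le_up (hne x i) v
      _ = (∑ _x : TorusSite 3 L, ∑ _i : Fin 3, n) -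
            1 / 2 * ∑ x : TorusSite 3 L, ∑ i : Fin 3, (p x + p (x + Pi.single i 1)) := by
          rw [Finset.mul_sum, ← Finset.sum_sub_distrib]
          refine Finset.sum_congr rfl fun x _ => ?_
          rw [Finset.mul_sum, ← Finset.sum_sub_distrib]
      _ = 3 * (L : ℝ) ^ 3 * n - 3 * ∑ x, p x := by
          rw [hdouble, Finset.sum_const, Finset.card_univ, Finset.sum_const, Finset.card_univ,
            Fintype.card_fin, nsmul_eq_mul, nsmul_eq_mul, hcard]
          push_cast
          ring
  rw [hH]
  rw [hsum] at hB1 hB2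
  rcases le_or_gt 0 M with hM | hM
  · rw [abs_of_nonneg hM]
    linarith
  · rw [abs_of_neg hM]
    linarith

end Summit.AtomisticToContinuum.BoseEinsteinCondensation.Theorems.LatticeODLROOffHalfFilling.Ladder
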